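import Literature.AnabelianGeometry.SemiGraphs.OneVertexWitness
import Literature.AnabelianGeometry.SemiGraphs.WitnessIwahoriApprox
import HarnessLib

/-!
# Any one-vertex, edgeless semi-graph of anabelioids over slim profinite groups with level families
# satisfies the hypotheses of [SemiAnbd] Prop. 3.6 / Thm. 3.7; the level family of `P = ℤ_p ⋊ (1 + pℤ_p)`

Mochizuki, *Semi-graphs of anabelioids*, Publ. RIMS **42** (2006) [MochizukiSemiAnbd2006], §2 Def. 2.3
(approximators, quasi-coherence, pp. 24–25), Def. 2.4 (elevated / aloof / estranged / verticially slim,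
pp. 25–26), Prop. 3.6 p. 38, Thm. 3.7 p. 40; [IUTchI] Rmk. 2.5.3 (i) (T2) (Galois-countability).

Proof-structure companion of `OneVertexWitness.lean` (abc-iut-L3-t2 gen 3: `OneVertex.graph P` with its
`LevelFamily` API, untouched and imported), abc-iut cell block F, seat abc-iut-f-177 (generalisation of the
carrier lemma `IwahoriWitness.restrict_cuspOmission_thm37Hypotheses` of the FACT-LIST row F-1727 counter-model,
`TemperedSpecialFibreReductionsSchemaS3.lean`).  `OneVertex.prop36Hypotheses` / `OneVertex.thm37Hypotheses` are
stated for the SPECIFIC presentation `OneVertex.graph P` (vertex type `PUnit`, edge type `PEmpty`); a restriction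
`𝒢.restrict H` of a semi-graph of anabelioids along a cusp omission down to one vertex (tree,
`TemperedCoveringsSubgraph.lean`) has subtype vertex / edge types instead.  This file proves the same bundle for an
ARBITRARY presentation `𝒢 : ProfiniteSemiGraph` with `Unique 𝒢.graph.Vertex` and `IsEmpty 𝒢.graph.Edge`, given a
level family on every (= the) vertex group and verticial slimness — verbatim the argument of
`OneVertexWitness.lean`: the approximators / splitting coverings are the finite quotients `Π_v/N_n`, there is no
edge to be aloof or estranged about, and the barycentric subdivision is a point:

* `ProfiniteSemiGraph.OneVertexEdgeless.prop36Hypotheses`, `….thm37Hypotheses`, and the `∃`-free wrapper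
  `thm37Hypotheses_of_unique_of_isEmpty` (explicit `Nonempty (Unique _)` / `IsEmpty _` arguments);
* `LevelFamily.iw p` — the level boxes `Ker(P ↠ P_n)` of `P = ℤ_p ⋊ (1 + pℤ_p)` (`Iw p`, abc-iut-L3 WIT-1b,
  `WitnessIwahoriApprox`) form a level family (open normal, finite quotients `≅ P_n` of order `≥ pⁿ`, a basis
  of neighbourhoods of `1`: `Iw.exists_level_subset_of_mem_nhds`) — so `OneVertex.graph (Iw p)` and every
  one-vertex edgeless presentation over `Iw p` (e.g. the cusp-omitted `IwahoriWitness.cuspGraph p`) fall under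
  the theorem.

A witness / infrastructure file: consistency only; no statement of the paper is touched, strengthened or
assumed; no instance, no notation, no `Prop` fact is declared.  Nothing here bears on [IUTchIII] Cor. 3.12.
-/

noncomputable section

namespace Literature.AnabelianGeometry.SemiGraphs

namespace ProfiniteSemiGraph

open CategoryTheory Topology
open Literature.AlgebraicGeometry.Frobenioids (IsSlimGroup)

universe u

/-! ### The level family of `P = ℤ_p ⋊ (1 + pℤ_p)` -/

/-- **The level family of `P = ℤ_p ⋊ (1 + pℤ_p)`**: the kernels of the reductions `P ↠ P_n`
(`Iw.toMod n`) — open normal subgroups with finite quotients `≅ P_n` of unbounded order (`P_n` contains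
the translation subgroup of order `pⁿ`, `IwMod.card_transl`), every neighbourhood of `1` containing one of
them. [cite: MochizukiSemiAnbd2006, Def 2.3 pp.24-25] -/
def LevelFamily.iw (p : ℕ) [Fact p.Prime] : LevelFamily (Iw p) where
  N n := (Iw.toMod (p := p) n).ker
  normal _ := inferInstance
  isOpen n := Iw.isOpen_ker_toMod n
  finiteQuotient n :=
    Finite.of_equiv _ (QuotientGroup.quotientKerEquivOfSurjective (Iw.toMod (p := p) n)
      (Iw.toMod_surjective n)).symm.toEquiv
  basis U hU h1 := by
    obtain ⟨n, hn⟩ := Iw.exists_level_subset_of_mem_nhds (hU.mem_nhds h1)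
    exact ⟨n, fun g hg => hn g ((MonoidHom.mem_ker).mp hg)⟩
  unbounded M := by
    refine ⟨M, ?_⟩
    rw [Nat.card_congr (QuotientGroup.quotientKerEquivOfSurjective (Iw.toMod (p := p) M)
      (Iw.toMod_surjective M)).toEquiv]
    calc M ≤ p ^ M := (Nat.lt_pow_self (Fact.out : p.Prime).one_lt).le
      _ = Nat.card (IwMod.transl (p := p) (n := M)) := (IwMod.card_transl (p := p) (n := M)).symm
      _ ≤ Nat.card (IwMod p M) := Subgroup.card_le_card_group _

/-- Membership in the `n`-th level of `LevelFamily.iw p` is `P ↠ P_n` vanishing.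
[cite: MochizukiSemiAnbd2006, Def 2.3 pp.24-25] -/
theorem LevelFamily.mem_iw_iff (p : ℕ) [Fact p.Prime] (n : ℕ) (g : Iw p) :
    g ∈ (LevelFamily.iw p).N n ↔ Iw.toMod n g = 1 := MonoidHom.mem_ker

/-! ### One-vertex edgeless presentations -/

namespace OneVertexEdgeless

variable (𝒢 : ProfiniteSemiGraph.{u})

/-- No edges, hence no branches. [cite: MochizukiSemiAnbd2006, §1 p.11] -/
theorem isEmpty_branch [IsEmpty 𝒢.graph.Edge] : IsEmpty 𝒢.graph.Branch := Function.isEmpty 𝒢.graph.edgeOf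

/-- Connected: the barycentric subdivision has one point. [cite: MochizukiSemiAnbd2006, §1 p.11] -/
theorem isConnected [Unique 𝒢.graph.Vertex] [IsEmpty 𝒢.graph.Edge] : 𝒢.IsConnected := by
  haveI := isEmpty_branch 𝒢
  refine ⟨@SimpleGraph.Connected.mk _ _ ?_ ⟨Sum.inl default⟩⟩
  intro a b
  rcases a with a | a | a
  · rcases b with b | b | b
    · rw [Subsingleton.elim a b]
    · exact isEmptyElim b
    · exact isEmptyElim b
  · exact isEmptyElim a
  · exact isEmptyElim a

/-- Countable. [cite: MochizukiSemiAnbd2006, §1 p.11] -/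
theorem isCountable [Unique 𝒢.graph.Vertex] [IsEmpty 𝒢.graph.Edge] : 𝒢.IsCountable :=
  ⟨inferInstance, inferInstance⟩

/-- Has a vertex. [cite: MochizukiSemiAnbd2006, Thm 3.7 p.40] -/
theorem hasVertex [Unique 𝒢.graph.Vertex] : 𝒢.HasVertex := ⟨default⟩

/-- Of injective type (no branches). [cite: MochizukiSemiAnbd2006, Def 2.1 p.22] -/
theorem isOfInjectiveType [IsEmpty 𝒢.graph.Edge] : 𝒢.IsOfInjectiveType :=
  haveI := isEmpty_branch 𝒢
  fun b => isEmptyElim b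

/-- Totally aloof (no edges). [cite: MochizukiSemiAnbd2006, Def 2.4(iv) p.26] -/
theorem isTotallyAloof [IsEmpty 𝒢.graph.Edge] : 𝒢.IsTotallyAloof := fun e => isEmptyElim e

/-- Totally estranged (no edges). [cite: MochizukiSemiAnbd2006, Def 2.4(iv) p.26] -/
theorem isTotallyEstranged [IsEmpty 𝒢.graph.Edge] : 𝒢.IsTotallyEstranged := fun e => isEmptyElim e

/-- The **approximator at level `n`**: the finite quotients `Π_v ↠ Π_v/N_n` at the vertices (no edges, no
branches). [cite: MochizukiSemiAnbd2006, Def 2.3 pp.24-25] -/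
def levelApproximator [Unique 𝒢.graph.Vertex] [IsEmpty 𝒢.graph.Edge]
    (L : ∀ v : 𝒢.graph.Vertex, LevelFamily (𝒢.Gv v)) (n : ℕ) : 𝒢.Approximator :=
  haveI := isEmpty_branch 𝒢
  { FV := fun v => 𝒢.Gv v ⧸ (L v).N n
    FE := fun e => isEmptyElim e
    groupFV := fun v => @QuotientGroup.Quotient.group _ _ ((L v).N n) ((L v).normal n)
    finiteFV := fun v => (L v).finiteQuotient n
    groupFE := fun e => isEmptyElim e
    finiteFE := fun e => isEmptyElim e
    πV := fun v => @QuotientGroup.mk' _ _ ((L v).N n) ((L v).normal n)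
    πE := fun e => isEmptyElim e
    isOpen_ker_πV := fun v => by
      haveI := (L v).normal n
      change IsOpen ((QuotientGroup.mk' ((L v).N n)).ker : Set (𝒢.Gv v))
      rw [QuotientGroup.ker_mk']
      exact (L v).isOpen n
    isOpen_ker_πE := fun e => isEmptyElim e
    brF := fun b => isEmptyElim b
    brF_injective := fun b => isEmptyElim b
    comm := fun b => isEmptyElim b
    bounded := ⟨Nat.card (𝒢.Gv default ⧸ (L default).N n),
      @Nat.card_pos _ ⟨QuotientGroup.mk 1⟩ ((L default).finiteQuotient n),
      fun v => by rw [Subsingleton.elim v default]⟩ }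

/-- The level approximators are `π₁`-epimorphic. [cite: MochizukiSemiAnbd2006, Def 2.3(ii) p.25] -/
theorem levelApproximator_isPiOneEpimorphic [Unique 𝒢.graph.Vertex] [IsEmpty 𝒢.graph.Edge]
    (L : ∀ v : 𝒢.graph.Vertex, LevelFamily (𝒢.Gv v)) (n : ℕ) : (levelApproximator 𝒢 L n).IsPiOneEpimorphic :=
  ⟨fun v =>
    haveI := (L v).normal n
    QuotientGroup.mk'_surjective ((L v).N n), fun e => isEmptyElim e⟩

/-- The kernel of the level-`n` approximator at `v` is `N_n`. [cite: MochizukiSemiAnbd2006, Def 2.3 pp.24-25] -/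
theorem levelApproximator_πV_eq_one_iff [Unique 𝒢.graph.Vertex] [IsEmpty 𝒢.graph.Edge]
    (L : ∀ v : 𝒢.graph.Vertex, LevelFamily (𝒢.Gv v)) (n : ℕ) (v : 𝒢.graph.Vertex) (g : 𝒢.Gv v) :
    (levelApproximator 𝒢 L n).πV v g = 1 ↔ g ∈ (L v).N n := by
  haveI := (L v).normal n
  change (QuotientGroup.mk' ((L v).N n)) g = 1 ↔ _
  exact QuotientGroup.eq_one_iff g

/-- Totally elevated: some approximator `Π_v/N_n` has order `≥ M`, and there is no edge group to avoid.
[cite: MochizukiSemiAnbd2006, Def 2.4(i) p.25] -/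
theorem isTotallyElevated [Unique 𝒢.graph.Vertex] [IsEmpty 𝒢.graph.Edge]
    (L : ∀ v : 𝒢.graph.Vertex, LevelFamily (𝒢.Gv v)) : 𝒢.IsTotallyElevated := by
  haveI := isEmpty_branch 𝒢
  intro v M
  obtain ⟨n, hn⟩ := (L v).unbounded M
  haveI := (L v).normal n
  refine ⟨levelApproximator 𝒢 L n, levelApproximator_isPiOneEpimorphic 𝒢 L n, ⊤, ?_,
    fun b => isEmptyElim b⟩
  haveI := (L v).finiteQuotient n
  calc M ≤ Nat.card (𝒢.Gv v ⧸ (L v).N n) := hn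
    _ = Nat.card (⊤ : Subgroup (𝒢.Gv v ⧸ (L v).N n)) := Subgroup.card_top.symm

/-- Quasi-coherent: a finite continuous `Π_v`-set is fixed by some `N_n`, i.e. split by the approximator of
level `n`. [cite: MochizukiSemiAnbd2006, Def 2.3(iii) p.25] -/
theorem isQuasiCoherent [Unique 𝒢.graph.Vertex] [IsEmpty 𝒢.graph.Edge]
    (L : ∀ v : 𝒢.graph.Vertex, LevelFamily (𝒢.Gv v)) : 𝒢.IsQuasiCoherent := by
  intro M HV HE hV _hE
  haveI : Finite (HV default).obj.V := (hV default).2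
  obtain ⟨n, hfix⟩ := OneVertex.exists_level_fixing (L default) (HV default)
  refine ⟨levelApproximator 𝒢 L n, ?_, fun e => isEmptyElim e⟩
  intro v g hg x
  have hv : v = default := Subsingleton.elim v default
  subst hv
  exact hfix g ((levelApproximator_πV_eq_one_iff 𝒢 L n _ g).mp hg) x

/-- The finite covering with vertex fibre `Π_v/N_n`. [cite: Mochizuki2012, IUTchI Rmk 2.5.3 (i) (T2), p. 52] -/
def levelCov [IsEmpty 𝒢.graph.Edge]
    (L : ∀ v : 𝒢.graph.Vertex, LevelFamily (𝒢.Gv v)) (n : ℕ) : CovObj 𝒢 :=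
  haveI := isEmpty_branch 𝒢
  { SV := fun v => OneVertex.levelObj (L v) n
    SE := fun e => isEmptyElim e
    glue := fun b => isEmptyElim b }

/-- The level coverings are finite. [cite: Mochizuki2012, IUTchI Rmk 2.5.3 (i) (T2), p. 52] -/
theorem levelCov_isFinite [IsEmpty 𝒢.graph.Edge]
    (L : ∀ v : 𝒢.graph.Vertex, LevelFamily (𝒢.Gv v)) (n : ℕ) : (levelCov 𝒢 L n).IsFinite :=
  ⟨fun v => (L v).finiteQuotient n, fun e => isEmptyElim e⟩

/-- The level coverings have nonempty fibres. [cite: Mochizuki2012, IUTchI Rmk 2.5.3 (i) (T2), p. 52] -/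
theorem levelCov_hasNonemptyFibres [IsEmpty 𝒢.graph.Edge]
    (L : ∀ v : 𝒢.graph.Vertex, LevelFamily (𝒢.Gv v)) (n : ℕ) : (levelCov 𝒢 L n).HasNonemptyFibres :=
  ⟨fun v => ⟨(QuotientGroup.mk (1 : 𝒢.Gv v) : 𝒢.Gv v ⧸ (L v).N n)⟩, fun e => isEmptyElim e⟩

/-- Galois-countable ([IUTchI] Rmk. 2.5.3 (i) (T2)): every finite covering is split, over the vertex
anabelioid, by some `Π_v/N_n`. [cite: Mochizuki2012, IUTchI Rmk 2.5.3 (i) (T2), p. 52] -/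
theorem isGaloisCountable [Unique 𝒢.graph.Vertex] [IsEmpty 𝒢.graph.Edge]
    (L : ∀ v : 𝒢.graph.Vertex, LevelFamily (𝒢.Gv v)) : 𝒢.IsGaloisCountable := by
  refine ⟨isCountable 𝒢, levelCov 𝒢 L,
    fun n => ⟨levelCov_isFinite 𝒢 L n, levelCov_hasNonemptyFibres 𝒢 L n⟩, fun H hH => ?_⟩
  haveI : Finite (H.SV default).obj.V := hH.finite_V default
  obtain ⟨n, hfix⟩ := OneVertex.exists_level_fixing (L default) (H.SV default)
  refine ⟨n, fun v x g hgx s => ?_, fun e => isEmptyElim e⟩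
  have hv : v = default := Subsingleton.elim v default
  subst hv
  exact hfix g (OneVertex.mem_level_of_fix (L default) n x g hgx) s

/-- **A one-vertex, edgeless semi-graph of anabelioids (any presentation) over slim profinite groups with
level families satisfies the hypotheses of [SemiAnbd] Proposition 3.6.**
[cite: MochizukiSemiAnbd2006, Prop 3.6 p.38] -/
theorem prop36Hypotheses [Unique 𝒢.graph.Vertex] [IsEmpty 𝒢.graph.Edge]
    (L : ∀ v : 𝒢.graph.Vertex, LevelFamily (𝒢.Gv v)) (hslim : 𝒢.IsVerticiallySlim) : 𝒢.Prop36Hypotheses where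
  isConnected := isConnected 𝒢
  isCountable := isCountable 𝒢
  isGaloisCountable := isGaloisCountable 𝒢 L
  hasVertex := hasVertex 𝒢
  isOfInjectiveType := isOfInjectiveType 𝒢
  isQuasiCoherent := isQuasiCoherent 𝒢 L
  isTotallyElevated := isTotallyElevated 𝒢 L
  isTotallyAloof := isTotallyAloof 𝒢
  isVerticiallySlim := hslim

/-- **… and the hypotheses of [SemiAnbd] Theorem 3.7.** [cite: MochizukiSemiAnbd2006, Thm 3.7 p.40] -/
theorem thm37Hypotheses [Unique 𝒢.graph.Vertex] [IsEmpty 𝒢.graph.Edge]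
    (L : ∀ v : 𝒢.graph.Vertex, LevelFamily (𝒢.Gv v)) (hslim : 𝒢.IsVerticiallySlim) : 𝒢.Thm37Hypotheses where
  toProp36Hypotheses := prop36Hypotheses 𝒢 L hslim
  isTotallyEstranged := isTotallyEstranged 𝒢

end OneVertexEdgeless

/-- Wrapper with explicit (non-instance) arguments: a presentation with exactly one vertex and no edge,
level families on the vertex groups and verticial slimness satisfies the hypotheses of Thm. 3.7.
[cite: MochizukiSemiAnbd2006, Thm 3.7 p.40] -/
theorem thm37Hypotheses_of_unique_of_isEmpty (𝒢 : ProfiniteSemiGraph.{u})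
    (hV : Nonempty (Unique 𝒢.graph.Vertex)) (hE : IsEmpty 𝒢.graph.Edge)
    (L : ∀ v : 𝒢.graph.Vertex, LevelFamily (𝒢.Gv v)) (hslim : 𝒢.IsVerticiallySlim) :
    𝒢.Thm37Hypotheses := by
  obtain ⟨hU⟩ := hV
  exact OneVertexEdgeless.thm37Hypotheses 𝒢 L hslim

/-- In particular the specific presentation `OneVertex.graph P` of `OneVertexWitness.lean` is an instance
(same conclusion as `OneVertex.thm37Hypotheses`, recovered from the generic theorem).
[cite: MochizukiSemiAnbd2006, Thm 3.7 p.40] -/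
theorem OneVertex.thm37Hypotheses' (P : Type u) [Group P] [TopologicalSpace P] [IsTopologicalGroup P]
    [CompactSpace P] [TotallyDisconnectedSpace P] (L : LevelFamily P) (hslim : IsSlimGroup P) :
    (OneVertex.graph P).Thm37Hypotheses :=
  thm37Hypotheses_of_unique_of_isEmpty (OneVertex.graph P)
    ⟨{ default := PUnit.unit, uniq := fun _ => rfl }⟩ ⟨fun e => nomatch e⟩ (fun _ => L) fun _ => hslim

end ProfiniteSemiGraph

end Literature.AnabelianGeometry.SemiGraphs

end
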